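import Summits.Ventures.HodgeRepro2.T5LocalDegreeBounds

/-!
# T5SplitPlaceLocalDegree — at a place of a quadratic extension with TWO primes above it, both
completions are the base completion: `[L_w : K_v] = [L_{w'} : K_v] = 1`

Tier-5 kernel support (N3, the split places) — p8, gen 15.  §8(d): uses an L-value-free
non-vanishing device: NO.

The record's «`v` split in `E`»: `E ⊗_F F_v = E_w × E_{w'} = F_v × F_v`.  In Mathlib's vocabulary
«split» is «two distinct primes `w ≠ w'` of `L` lie over `v`»; Mathlib's
`Ideal.sum_ramification_inertia` bounds `e(w/v) f(w/v) + e(w'/v) f(w'/v) ≤ [L : K] = 2`, so each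
product is `1`, and the local degree formula (`T5InertGlobalToLocal`) gives `[L_w : K_v] = 1`,
i.e. `K_v → L_w` is bijective (`T5LocalDegreeBounds`):
* `ramificationIdx'_mul_inertiaDeg'_eq_one_of_ne` — `e(w/v) f(w/v) = 1` for each of the two
  primes;
* `finrank_adicCompletion_eq_one_of_ne` / `bijective_algebraMap_adicCompletion_of_ne` — each
  factor of the record's `E_v = F_v × F_v`.

Nothing here identifies which places of the datum split.
-/

namespace Summit.Ventures.HodgeRepro2.T5SplitPlaceLocalDegree

open IsDedekindDomain HeightOneSpectrum NumberField

variable {K : Type*} [Field K] [NumberField K] (v : HeightOneSpectrum (RingOfIntegers K))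
variable {L : Type*} [Field L] [NumberField L] [Algebra K L]
  (w w' : HeightOneSpectrum (RingOfIntegers L)) [w.asIdeal.LiesOver v.asIdeal]
  [w'.asIdeal.LiesOver v.asIdeal]

/-- Two distinct primes over `v` contribute at least `e f + e' f'` to Mathlib's
`Σ_{P ∣ v} e(P/v) f(P/v) = [L : K]`. -/
theorem add_le_finrank_of_ne (hne : w ≠ w') :
    v.asIdeal.ramificationIdx' w.asIdeal * v.asIdeal.inertiaDeg' w.asIdeal +
      v.asIdeal.ramificationIdx' w'.asIdeal * v.asIdeal.inertiaDeg' w'.asIdeal ≤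
      Module.finrank K L := by
  classical
  haveI : v.asIdeal.IsMaximal := v.isMaximal
  rw [← Ideal.sum_ramification_inertia (𝓞 L) K L (p := v.asIdeal) v.ne_bot]
  have hw : w.asIdeal ∈ IsDedekindDomain.primesOverFinset v.asIdeal (𝓞 L) :=
    (IsDedekindDomain.mem_primesOverFinset_iff v.ne_bot _).2 ⟨w.isPrime, inferInstance⟩
  have hw' : w'.asIdeal ∈ IsDedekindDomain.primesOverFinset v.asIdeal (𝓞 L) :=
    (IsDedekindDomain.mem_primesOverFinset_iff v.ne_bot _).2 ⟨w'.isPrime, inferInstance⟩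
  have hne' : w.asIdeal ≠ w'.asIdeal := fun h => hne (HeightOneSpectrum.ext h)
  calc v.asIdeal.ramificationIdx' w.asIdeal * v.asIdeal.inertiaDeg' w.asIdeal +
        v.asIdeal.ramificationIdx' w'.asIdeal * v.asIdeal.inertiaDeg' w'.asIdeal
      = ∑ P ∈ ({w.asIdeal, w'.asIdeal} : Finset (Ideal (𝓞 L))),
          v.asIdeal.ramificationIdx' P * v.asIdeal.inertiaDeg' P := by
        rw [Finset.sum_pair hne']
    _ ≤ ∑ P ∈ IsDedekindDomain.primesOverFinset v.asIdeal (𝓞 L),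
          v.asIdeal.ramificationIdx' P * v.asIdeal.inertiaDeg' P :=
        Finset.sum_le_sum_of_subset_of_nonneg (by
          intro P hP
          rw [Finset.mem_insert, Finset.mem_singleton] at hP
          rcases hP with rfl | rfl
          · exact hw
          · exact hw') (fun _ _ _ => Nat.zero_le _)

/-- `e(w/v) f(w/v) ≥ 1`. -/
theorem one_le_ramificationIdx'_mul_inertiaDeg' :
    1 ≤ v.asIdeal.ramificationIdx' w.asIdeal * v.asIdeal.inertiaDeg' w.asIdeal := by
  haveI : v.asIdeal.IsMaximal := v.isMaximal
  have he := Ideal.IsDedekindDomain.ramificationIdx'_ne_zero_of_liesOver (p := v.asIdeal) w.asIdeal v.ne_bot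
  have hf := Ideal.inertiaDeg'_ne_zero v.asIdeal w.asIdeal
  exact Nat.one_le_iff_ne_zero.2 (mul_ne_zero he hf)

/-- In a quadratic `L / K`, if two distinct primes `w ≠ w'` lie over `v` then `e(w/v) f(w/v) = 1`
(«`v` splits»). -/
theorem ramificationIdx'_mul_inertiaDeg'_eq_one_of_ne (h2 : Module.finrank K L = 2)
    (hne : w ≠ w') :
    v.asIdeal.ramificationIdx' w.asIdeal * v.asIdeal.inertiaDeg' w.asIdeal = 1 := by
  have h := add_le_finrank_of_ne v w w' hne
  have h1 := one_le_ramificationIdx'_mul_inertiaDeg' v w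
  have h1' := one_le_ramificationIdx'_mul_inertiaDeg' v w'
  omega

/-- At a split place of a quadratic extension the local degree is `1`. -/
theorem finrank_adicCompletion_eq_one_of_ne (h2 : Module.finrank K L = 2) (hne : w ≠ w') :
    Module.finrank (v.adicCompletion K) (w.adicCompletion L) = 1 := by
  rw [T5InertGlobalToLocal.finrank_adicCompletion_eq_mul v w]
  exact ramificationIdx'_mul_inertiaDeg'_eq_one_of_ne v w w' h2 hne

/-- At a split place of a quadratic extension `K_v → L_w` is bijective: each factor of the
record's `E_v = F_v × F_v` is `F_v`. -/
theorem bijective_algebraMap_adicCompletion_of_ne (h2 : Module.finrank K L = 2) (hne : w ≠ w') :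
    Function.Bijective (algebraMap (v.adicCompletion K) (w.adicCompletion L)) :=
  Algebra.finrank_eq_one_iff_bijective_algebraMap.1
    (finrank_adicCompletion_eq_one_of_ne v w w' h2 hne)

/-- `e(w/v) = 1` and `f(w/v) = 1` at a split place of a quadratic extension. -/
theorem ramificationIdx'_eq_one_and_inertiaDeg'_eq_one_of_ne (h2 : Module.finrank K L = 2)
    (hne : w ≠ w') :
    v.asIdeal.ramificationIdx' w.asIdeal = 1 ∧ v.asIdeal.inertiaDeg' w.asIdeal = 1 :=
  mul_eq_one.1 (ramificationIdx'_mul_inertiaDeg'_eq_one_of_ne v w w' h2 hne)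

end Summit.Ventures.HodgeRepro2.T5SplitPlaceLocalDegree
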